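import Summits.Schanuel.Schanuel.Theorems.ZilberEacFastPoleFibreEstimates
import Summits.Schanuel.Schanuel.Theorems.ZilberEacBranchPoleFibreGrowth
import HarnessLib

/-!
# Arbitrary base branches, LXXX(c): FAST-regime pole / zero fibre values are ALWAYS dense —
# no direction condition, no condition on the Puiseux tail

HONEST FRAMING.  Cell `pub-schanuel` (Zilber's Exponential-Algebraic Closedness, case ladder;
host summit Schanuel), seat 2, gen 32.  A cylinder germ `(s^{-k}, Φ(s)s^{-M}, ψ(s)s^L, e^{x₁})` with
`1 ≤ k < M`, `L ≠ 0`, `ψ(0) ≠ 0`, `Φ(0) ≠ 0`, in an irreducible closed `S` of dimension `≤ 2`, is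
Zariski dense among the exponential points: **`unprojectedDense_branch_poleFibre_fast`** (file XXXII
needed a good direction, file XXXV the bad direction with `Φ − Φ(0) = O(s^k)`).  Along the points of
file XXXI write `Φ(s)s^{-M} = Σ_{j≤M} c_j(zEu^{-1})^j + R(s)` and split at `j = M − k` (file
LXXX(b)): if the real polynomial `g = Re Σ_{j>M−k} c_j z^j X^j` is nonzero, it has degree
`d ≥ M − k + 1` and dominates all corrections (`O(E^{M−k} log n)`) — THEOREM G at rate `E^d`;
if `g = 0`, the top correction carries `−(ML/k²)(Im(Φ(0)z^M)/2π)·E^{M−k}log n` (second order in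
`(1+ε)^{M/k}`), which dominates — THEOREM G at rate `E^{M−k}log n`.  Decided instances of an OPEN
question (Mantova–Masser, PLMS 2024 §1 p. 5); EC(3,2) OPEN; NOT Schanuel's conjecture (neither used
nor implied); EAC ⇏ SC.
-/

noncomputable section

open Filter Topology Metric Complex Polynomial
open Literature.NumberTheory.Transcendental Literature.ModelTheory.Zilber
open Literature.ModelTheory.ExponentialFields

set_option linter.dupNamespace false

namespace Summit.Schanuel.Schanuel.Theorems

/-- **Fast-regime pole / zero fibre values: dense, unconditionally.**  See the module docstring.
[cite: MantovaMasser2023, §1 Further remarks, p. 5 (the question, open in general)] (new) -/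
theorem unprojectedDense_branch_poleFibre_fast {S : Set (Fin 2 ⊕ Fin 2 → ℂ)}
    (hS : IsIrreducibleClosed ℂ S) (hdim : zariskiDim ℂ S ≤ (2 : ℕ))
    {k M : ℕ} (hk : 1 ≤ k) (hkM : k < M) {L : ℤ} (hL : L ≠ 0) {ψ : ℂ → ℂ} (hψ : AnalyticAt ℂ ψ 0)
    (hψ0 : ψ 0 ≠ 0) {Φ : ℂ → ℂ} (hΦ : AnalyticAt ℂ Φ 0) (hΦ0 : Φ 0 ≠ 0)
    (hgerm : ∀ᶠ s in 𝓝[≠] (0 : ℂ),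
      (Sum.elim ![(s ^ k)⁻¹, Φ s * (s ^ M)⁻¹] ![ψ s * s ^ L, Complex.exp (Φ s * (s ^ M)⁻¹)] :
        Fin 2 ⊕ Fin 2 → ℂ) ∈ S) :
    UnprojectedDense S := by
  classical
  have hk0 : k ≠ 0 := by omega
  have hkR : (0 : ℝ) < k := by exact_mod_cast Nat.pos_of_ne_zero hk0
  have hk1 : (1 : ℝ) ≤ k := by exact_mod_cast hk
  have hMR : (0 : ℝ) < M := by exact_mod_cast (show 0 < M by omega)
  obtain ⟨z, hz⟩ := IsAlgClosed.exists_pow_nat_eq (2 * Real.pi * I : ℂ) (by omega : 0 < k)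
  have h2πI : (2 * Real.pi * I : ℂ) ≠ 0 := by simp [Real.pi_ne_zero, Complex.I_ne_zero]
  have hz0 : z ≠ 0 := by
    rintro rfl
    rw [zero_pow hk0] at hz
    exact h2πI hz.symm
  obtain ⟨N₀, u, s, w, W, hN₀, hu, hu0, hwW, hudef, hsu, hs0, hs, hexp⟩ :=
    exists_poleFibre_expPoints hk L hψ hψ0 hz
  obtain ⟨ε, huε, hnε, hεle, hεt⟩ := poleFibre_eps_facts L hN₀ hwW hudef
  have hW0 : 0 ≤ W := (norm_nonneg _).trans (hwW 0)
  obtain ⟨Pol, R, hPdeg, hPk, hRan, hsplit⟩ := exists_taylor_split_coeff hΦ M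
  have hsW : Tendsto s atTop (𝓝[≠] (0 : ℂ)) :=
    tendsto_nhdsWithin_iff.2 ⟨hs, Eventually.of_forall hs0⟩
  obtain ⟨J₀, hJ₀⟩ := Filter.eventually_atTop.1 (hsW.eventually hgerm)
  set n : ℕ → ℕ := fun m => N₀ + (J₀ + m) with hn
  have hn1 : ∀ m, (1 : ℝ) ≤ (n m : ℝ) := fun m => by
    simp only [hn]; exact_mod_cast (show 1 ≤ N₀ + (J₀ + m) by omega)
  have hnpos : ∀ m, (0 : ℝ) < (n m : ℝ) := fun m => by linarith [hn1 m]
  set p : ℕ → Fin 2 ⊕ Fin 2 → ℂ := fun m =>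
    Sum.elim ![(s (J₀ + m) ^ k)⁻¹, Φ (s (J₀ + m)) * (s (J₀ + m) ^ M)⁻¹]
      ![ψ (s (J₀ + m)) * s (J₀ + m) ^ L, Complex.exp (Φ (s (J₀ + m)) * (s (J₀ + m) ^ M)⁻¹)]
    with hp
  have hpS : ∀ m, p m ∈ S := fun m => hJ₀ (J₀ + m) (Nat.le_add_right _ _)
  have hpΓ : ∀ m, p m ∈ expGraph ℂ 2 := by
    intro m
    rw [mem_expGraph_iff]
    intro i
    rw [Literature.ModelTheory.ExponentialFields.ExponentialRing.complex_exp_eq]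
    fin_cases i
    · simp [hp, hexp (J₀ + m)]
    · simp [hp]
  -- labels `ℓ = log n → ∞`, scale `E = e^{ℓ/k}` (`E^k = n`)
  set ℓ : ℕ → ℝ := fun m => Real.log (n m : ℝ) with hℓ
  have hℓ0 : ∀ m, 0 ≤ ℓ m := fun m => Real.log_nonneg (hn1 m)
  have hℓt : Tendsto ℓ atTop atTop := by
    rw [hℓ]
    refine Real.tendsto_log_atTop.comp (tendsto_natCast_atTop_atTop.comp ?_)
    exact (tendsto_add_atTop_nat (N₀ + J₀)).congr fun m => by simp only [hn]; omega
  set E : ℕ → ℝ := fun m => Real.exp (ℓ m / k) with hE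
  have hE1 : ∀ m, 1 ≤ E m := fun m => Real.one_le_exp (div_nonneg (hℓ0 m) hkR.le)
  have hEpos : ∀ m, 0 < E m := fun m => Real.exp_pos _
  have hEpow : ∀ m (j : ℕ), E m ^ j = Real.exp ((j : ℝ) * (ℓ m / k)) := fun m j =>
    (Real.exp_nat_mul _ _).symm
  have hEk : ∀ m, E m ^ k = (n m : ℝ) := fun m => by
    rw [hEpow, show (k : ℝ) * (ℓ m / k) = ℓ m by field_simp, hℓ, Real.exp_log (hnpos m)]
  have hst : Tendsto (fun m => s (J₀ + m)) atTop (𝓝 0) :=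
    hs.comp ((tendsto_add_atTop_nat J₀).congr fun m => by ring)
  -- `s⁻¹ = z·E·v`, `v = u⁻¹ → 1`
  set v : ℕ → ℂ := fun m => (u (J₀ + m))⁻¹ with hv
  have hcast : ∀ m, (-(Real.log ((N₀ + (J₀ + m) : ℕ) : ℝ) : ℂ) / k) = -(((ℓ m / k : ℝ) : ℂ)) := by
    intro m
    simp only [hℓ, hn]
    push_cast
    ring
  have hsinv : ∀ m, (s (J₀ + m))⁻¹ = z * ((E m : ℝ) : ℂ) * v m := by
    intro m
    rw [hsu (J₀ + m), mul_inv, mul_inv, inv_inv, hcast m, Complex.exp_neg, inv_inv,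
      Complex.ofReal_exp]
  have hut : Tendsto (fun m => u (J₀ + m)) atTop (𝓝 1) :=
    hu.comp ((tendsto_add_atTop_nat J₀).congr fun m => by ring)
  have hvt : Tendsto v atTop (𝓝 1) := by
    have h := hut.inv₀ one_ne_zero
    rw [inv_one] at h
    exact h
  have hv2 : ∀ᶠ m in atTop, ‖v m‖ ≤ 2 := by
    filter_upwards [Metric.tendsto_nhds.1 hvt 1 one_pos] with m hm
    rw [dist_eq_norm] at hm
    have := norm_le_norm_add_norm_sub' (v m) 1
    rw [norm_one] at this
    linarith
  -- the `ε` of the points: size `E^k‖ε‖ ≤ Aℓ + B`, powers of `v`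
  set εm : ℕ → ℂ := fun m => ε (J₀ + m) with hεm
  obtain ⟨A, hA⟩ : ∃ A : ℝ, A = (|(L : ℝ)| / k) / (2 * Real.pi) := ⟨_, rfl⟩
  obtain ⟨B, hB⟩ : ∃ B : ℝ, B = W / (2 * Real.pi) := ⟨_, rfl⟩
  have hA0 : 0 ≤ A := by rw [hA]; positivity
  have hB0 : 0 ≤ B := by rw [hB]; positivity
  have hεmt : Tendsto (fun m => ‖εm m‖) atTop (𝓝 0) :=
    hεt.comp ((tendsto_add_atTop_nat J₀).congr fun m => by ring)
  have hEkε : ∀ m, E m ^ k * ‖εm m‖ ≤ A * ℓ m + B := by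
    intro m
    rw [hEk m]
    have hn0 : (n m : ℝ) ≠ 0 := (hnpos m).ne'
    have h := hεle (J₀ + m)
    calc (n m : ℝ) * ‖εm m‖ ≤ (n m : ℝ) * (((|(L : ℝ)| / k) * ℓ m + W) / (2 * Real.pi * (n m : ℝ))) :=
          mul_le_mul_of_nonneg_left h (hnpos m).le
      _ = A * ℓ m + B := by rw [hA, hB]; field_simp
  have hvpow : ∀ m (j : ℕ), v m ^ j =
      Complex.exp ((((j : ℝ) / k : ℝ) : ℂ) * Complex.log (1 + εm m)) := fun m j =>
    inv_pow_eq_exp_mul_log hk (huε (J₀ + m)) j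
  have hsmall : ∀ᶠ m in atTop, ‖εm m‖ ≤ 1 / (3 * M) := by
    have : (0 : ℝ) < 1 / (3 * M) := by positivity
    filter_upwards [Metric.tendsto_nhds.1 hεmt _ this] with m hm
    rw [Real.dist_eq, sub_zero, abs_of_nonneg (norm_nonneg _)] at hm
    exact hm.le
  have hM1' : 1 ≤ M := by omega
  have hfirst : ∀ᶠ m in atTop, ∀ j : ℕ, j ≤ M → ‖v m ^ j - 1‖ ≤ 3 * M * ‖εm m‖ := by
    filter_upwards [hsmall] with m hm j hj
    rw [hvpow m j]
    exact norm_unitPow_sub_one_le hk hM1' hj hm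
  -- the decomposition of `x₁` (file LXXX(b))
  set c : ℕ → ℂ := fun j => Pol.coeff j with hc
  set m₀ : ℕ := M - k + 1 with hm₀
  have hm₀M : m₀ ≤ M + 1 := by omega
  have hm₀M' : m₀ ≤ M := by omega
  set T : Finset ℕ := Finset.Ico m₀ (M + 1) with hT
  have hTle : ∀ j ∈ T, j ≤ M := fun j hj => by have := (Finset.mem_Ico.1 hj).2; omega
  obtain ⟨low, hlow⟩ : ∃ low : ℕ → ℂ, low = fun m =>
      ∑ j ∈ Finset.range m₀, c j * (z * ((E m : ℝ) : ℂ) * v m) ^ j := ⟨_, rfl⟩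
  obtain ⟨hiMain, hhiMain⟩ : ∃ hiMain : ℕ → ℂ, hiMain = fun m =>
      ∑ j ∈ T, c j * z ^ j * ((E m : ℝ) : ℂ) ^ j := ⟨_, rfl⟩
  obtain ⟨hiCorr, hhiCorr⟩ : ∃ hiCorr : ℕ → ℂ, hiCorr = fun m =>
      ∑ j ∈ T, c j * z ^ j * ((E m : ℝ) : ℂ) ^ j * (v m ^ j - 1) := ⟨_, rfl⟩
  have hx1 : ∀ m, p m (Sum.inl 1) = low m + hiMain m + hiCorr m + R (s (J₀ + m)) := by
    intro m
    have h1 : p m (Sum.inl 1) = Φ (s (J₀ + m)) * (s (J₀ + m))⁻¹ ^ M := by simp [hp, inv_pow]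
    simp only [hlow, hhiMain, hhiCorr]
    rw [h1, hsplit _ (hs0 _), hsinv m,
      eval_mul_mul_split Pol (by omega : Pol.natDegree < M + 1) hm₀M z _ (v m)]
  -- the real polynomial of the high main part
  obtain ⟨gR, hgR⟩ : ∃ gR : ℝ[X], gR = ∑ j ∈ T, Polynomial.monomial j (c j * z ^ j).re := ⟨_, rfl⟩
  have hgRev : ∀ m, (hiMain m).re = gR.eval (E m) := by
    intro m
    simp only [hhiMain, hgR, Complex.re_sum, Polynomial.eval_finsetSum]
    refine Finset.sum_congr rfl fun j _ => ?_
    rw [Polynomial.eval_monomial, ← Complex.ofReal_pow, Complex.re_mul_ofReal]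
  have hgRcoeff : ∀ i, gR.coeff i = if i ∈ T then (c i * z ^ i).re else 0 := by
    intro i
    simp only [hgR, Polynomial.finsetSum_coeff, Polynomial.coeff_monomial]
    rw [Finset.sum_ite_eq' T i]
  -- bounds for the low part, the corrections, `R`, and `‖x₁‖`
  obtain ⟨Clo, hClo⟩ : ∃ Clo : ℝ, Clo = (∑ j ∈ Finset.range m₀, ‖c j‖) * (2 * ‖z‖ + 1) ^ (M - k) :=
    ⟨_, rfl⟩
  have hlowb : ∀ᶠ m in atTop, ‖low m‖ ≤ Clo * E m ^ (M - k) := by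
    filter_upwards [hv2] with m hvm
    simp only [hlow]
    rw [hClo]
    exact norm_lowSum_le' c z (v m) (hE1 m) hvm (m₀ := m₀) (d := M - k) (by omega)
  obtain ⟨Chi, hChi⟩ : ∃ Chi : ℝ, Chi = (∑ j ∈ T, ‖c j‖ * (‖z‖ + 1) ^ M) * (3 * M) := ⟨_, rfl⟩
  have hcorrb : ∀ᶠ m in atTop, ‖hiCorr m‖ ≤ Chi * (E m ^ (M - k) * (A * ℓ m + B)) := by
    filter_upwards [hfirst] with m hfm
    simp only [hhiCorr]
    rw [hChi]
    exact norm_corrSum_le' c z (v m) (hE1 m) hkM.le hTle (fun j hj => hfm j (hTle j hj)) (hEkε m)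
  have hRb : ∀ᶠ m in atTop, ‖R (s (J₀ + m))‖ ≤ ‖R 0‖ + 1 := by
    have h1 : Tendsto (fun m => R (s (J₀ + m))) atTop (𝓝 (R 0)) :=
      hRan.continuousAt.tendsto.comp hst
    filter_upwards [Metric.tendsto_nhds.1 h1 1 one_pos] with m hm
    rw [dist_eq_norm] at hm
    have := norm_le_norm_add_norm_sub' (R (s (J₀ + m))) (R 0)
    linarith
  have hnorm : ∀ᶠ m in atTop, ‖p m (Sum.inl 1)‖ ≤ Real.exp (((M : ℝ) / k + 1) * ℓ m) := by
    have hΦb : ∀ᶠ m in atTop, ‖Φ (s (J₀ + m))‖ ≤ ‖Φ 0‖ + 1 := by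
      have h1 : Tendsto (fun m => Φ (s (J₀ + m))) atTop (𝓝 (Φ 0)) := hΦ.continuousAt.tendsto.comp hst
      filter_upwards [Metric.tendsto_nhds.1 h1 1 one_pos] with m hm
      rw [dist_eq_norm] at hm
      have := norm_le_norm_add_norm_sub' (Φ (s (J₀ + m))) (Φ 0)
      linarith
    have hbig : ∀ᶠ m in atTop, (‖Φ 0‖ + 1) * (‖z‖ * 2) ^ M ≤ Real.exp (ℓ m) :=
      (Real.tendsto_exp_atTop.comp hℓt).eventually (eventually_ge_atTop _)
    filter_upwards [hΦb, hv2, hbig] with m hΦm hvm hbm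
    have h1 : p m (Sum.inl 1) = Φ (s (J₀ + m)) * (s (J₀ + m) ^ M)⁻¹ := by simp [hp]
    rw [h1]
    exact norm_place_coordinate_le (hEpos m) (hsinv m) hvm (hEpow m M) hΦm hbm
  have hre : ∀ m, (p m (Sum.inl 1)).re = (low m).re + gR.eval (E m) + (hiCorr m).re +
      (R (s (J₀ + m))).re := by
    intro m
    rw [hx1 m, Complex.add_re, Complex.add_re, Complex.add_re, hgRev m]
  by_cases hgR0 : gR = 0
  · /- (B) `Re g ≡ 0`: the logarithmic term of the top correction dominates -/
    have hMT : M ∈ T := Finset.mem_Ico.2 ⟨hm₀M', Nat.lt_succ_self M⟩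
    have htopre : (c M * z ^ M).re = 0 := by
      have h := hgRcoeff M
      rw [hgR0, Polynomial.coeff_zero, if_pos hMT] at h
      exact h.symm
    have haz : c M * z ^ M ≠ 0 := by
      simp only [hc, hPk]
      exact mul_ne_zero hΦ0 (pow_ne_zero _ hz0)
    set τ₀ : ℝ := (c M * z ^ M).im with hτ₀
    have hτ₀0 : τ₀ ≠ 0 := by
      intro h0
      apply haz
      apply Complex.ext
      · rw [htopre]; rfl
      · rw [Complex.zero_im, ← h0]
    -- mid corrections and the top correction
    set T' : Finset ℕ := Finset.Ico m₀ M with hT'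
    have hT'le : ∀ j ∈ T', j ≤ M - 1 := fun j hj => by have := (Finset.mem_Ico.1 hj).2; omega
    obtain ⟨mid, hmid⟩ : ∃ mid : ℕ → ℂ, mid = fun m =>
        ∑ j ∈ T', c j * z ^ j * ((E m : ℝ) : ℂ) ^ j * (v m ^ j - 1) := ⟨_, rfl⟩
    have hsplit2 : ∀ m, hiCorr m = mid m + c M * z ^ M * ((E m : ℝ) : ℂ) ^ M * (v m ^ M - 1) := by
      intro m
      simp only [hhiCorr, hmid, hT, hT']
      rw [Finset.sum_Ico_succ_top hm₀M']
    obtain ⟨Cmid, hCmid⟩ : ∃ Cmid : ℝ, Cmid = (∑ j ∈ T', ‖c j‖ * (‖z‖ + 1) ^ (M - 1)) * (3 * M) :=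
      ⟨_, rfl⟩
    have hmidb : ∀ᶠ m in atTop, ‖mid m‖ ≤ Cmid * (E m ^ (M - 1 - k) * (A * ℓ m + B)) := by
      filter_upwards [hfirst] with m hfm
      simp only [hmid]
      rw [hCmid]
      exact norm_corrSum_le' c z (v m) (hE1 m) (by omega : k ≤ M - 1) hT'le
        (fun j hj => hfm j (by have := hT'le j hj; omega)) (hEkε m)
    -- second-order expansion of `v^M − 1`
    obtain ⟨Cr, hCr⟩ : ∃ Cr : ℝ, Cr = 3 * ((M : ℝ) / k) ^ 2 + (M : ℝ) / k := ⟨_, rfl⟩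
    have hCr0 : 0 ≤ Cr := by rw [hCr]; positivity
    obtain ⟨r, hr⟩ : ∃ r : ℕ → ℂ, r = fun m => v m ^ M - 1 - (((M : ℝ) / k : ℝ) : ℂ) * εm m :=
      ⟨_, rfl⟩
    have hsecond : ∀ᶠ m in atTop, ‖r m‖ ≤ Cr * ‖εm m‖ ^ 2 := by
      filter_upwards [hsmall] with m hm
      simp only [hr]
      rw [hvpow m M, hCr]
      exact norm_unitPowTop_sub_sub_le hk hM1' hm
    -- the exact first-order top term
    set X : ℕ → ℂ := fun m => (-(L : ℂ) / k) * (ℓ m : ℂ) + w (J₀ + m) with hX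
    have hXre : ∀ m, (X m).re = -(L : ℝ) / k * ℓ m + (w (J₀ + m)).re := by
      intro m
      simp only [hX, Complex.add_re]
      congr 1
      have : (-(L : ℂ) / k) * (ℓ m : ℂ) = (((-(L : ℝ) / k * ℓ m) : ℝ) : ℂ) := by push_cast; ring
      rw [this, Complex.ofReal_re]
    have hEMε : ∀ m, ((E m : ℝ) : ℂ) ^ M * εm m =
        ((E m ^ (M - k) : ℝ) : ℂ) * (X m / (2 * Real.pi * I)) := by
      intro m
      have e1 : ((E m : ℝ) : ℂ) ^ M = ((E m ^ (M - k) : ℝ) : ℂ) * ((n m : ℕ) : ℂ) := by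
        rw [← Complex.ofReal_pow, show E m ^ M = E m ^ (M - k) * E m ^ k by
          rw [← pow_add, Nat.sub_add_cancel hkM.le], hEk m]
        push_cast
        rfl
      have e3 := hnε (J₀ + m)
      rw [e1, mul_assoc]
      congr 1
      rw [eq_div_iff h2πI]
      simp only [hX, hεm, hℓ, hn]
      linear_combination e3
    have htop : ∀ m, c M * z ^ M * ((E m : ℝ) : ℂ) ^ M * (v m ^ M - 1) =
        c M * z ^ M * ((((M : ℝ) / k : ℝ) : ℂ)) * ((E m ^ (M - k) : ℝ) : ℂ) * (X m / (2 * Real.pi * I))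
          + c M * z ^ M * ((E m : ℝ) : ℂ) ^ M * r m := by
      intro m
      have h1 : v m ^ M - 1 = (((M : ℝ) / k : ℝ) : ℂ) * εm m + r m := by simp only [hr]; ring
      rw [h1]
      have h2 := hEMε m
      linear_combination (c M * z ^ M * (((M : ℝ) / k : ℝ) : ℂ)) * h2
    obtain ⟨κ₀, hκ₀⟩ : ∃ κ₀ : ℝ, κ₀ = (M : ℝ) / k * (τ₀ / (2 * Real.pi)) * (-(L : ℝ) / k) := ⟨_, rfl⟩
    have hκ₀0 : κ₀ ≠ 0 := by
      rw [hκ₀]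
      refine mul_ne_zero (mul_ne_zero (by positivity) (div_ne_zero hτ₀0 (by positivity))) ?_
      exact div_ne_zero (neg_ne_zero.2 (Int.cast_ne_zero.2 hL)) hkR.ne'
    have htopre' : ∀ m, (c M * z ^ M * ((E m : ℝ) : ℂ) ^ M * (v m ^ M - 1)).re =
        κ₀ * (E m ^ (M - k) * ℓ m) +
          ((M : ℝ) / k * E m ^ (M - k) * (τ₀ / (2 * Real.pi)) * (w (J₀ + m)).re +
            (c M * z ^ M * ((E m : ℝ) : ℂ) ^ M * r m).re) := by
      intro m
      rw [htop m, Complex.add_re, re_top_first_order htopre, hXre m, ← hτ₀, hκ₀]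
      ring
    -- the error bound
    obtain ⟨CR, hCR⟩ : ∃ CR : ℝ, CR = ‖R 0‖ + 1 := ⟨_, rfl⟩
    obtain ⟨Cw, hCw⟩ : ∃ Cw : ℝ, Cw = (M : ℝ) / k * (|τ₀| / (2 * Real.pi)) * W := ⟨_, rfl⟩
    obtain ⟨Cz, hCz⟩ : ∃ Cz : ℝ, Cz = ‖c M * z ^ M‖ * Cr := ⟨_, rfl⟩
    have hErr : ∀ᶠ m in atTop, |(p m (Sum.inl 1)).re - κ₀ * (E m ^ (M - k) * ℓ m)| ≤
        Clo * E m ^ (M - k) + Cmid * (E m ^ (M - 1 - k) * (A * ℓ m + B)) + Cw * E m ^ (M - k) +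
          Cz * (E m ^ (M - k) * (‖εm m‖ * (A * ℓ m + B))) + CR := by
      filter_upwards [hlowb, hmidb, hsecond, hRb] with m hlo hmi hse hRm
      have h1 : |(low m).re| ≤ Clo * E m ^ (M - k) := (Complex.abs_re_le_norm _).trans hlo
      have h2 : |(mid m).re| ≤ Cmid * (E m ^ (M - 1 - k) * (A * ℓ m + B)) :=
        (Complex.abs_re_le_norm _).trans hmi
      have h3 : |(M : ℝ) / k * E m ^ (M - k) * (τ₀ / (2 * Real.pi)) * (w (J₀ + m)).re| ≤
          Cw * E m ^ (M - k) := by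
        rw [hCw, abs_mul, abs_mul, abs_mul, abs_of_nonneg (by positivity : (0 : ℝ) ≤ (M : ℝ) / k),
          abs_of_nonneg (by positivity : (0 : ℝ) ≤ E m ^ (M - k)), abs_div,
          abs_of_pos (by positivity : (0 : ℝ) < 2 * Real.pi)]
        have hw' := (Complex.abs_re_le_norm (w (J₀ + m))).trans (hwW _)
        have h0 : 0 ≤ (M : ℝ) / k * E m ^ (M - k) * (|τ₀| / (2 * Real.pi)) := by positivity
        calc (M : ℝ) / k * E m ^ (M - k) * (|τ₀| / (2 * Real.pi)) * |(w (J₀ + m)).re|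
            ≤ (M : ℝ) / k * E m ^ (M - k) * (|τ₀| / (2 * Real.pi)) * W :=
              mul_le_mul_of_nonneg_left hw' h0
          _ = (M : ℝ) / k * (|τ₀| / (2 * Real.pi)) * W * E m ^ (M - k) := by ring
      have h4 : |(c M * z ^ M * ((E m : ℝ) : ℂ) ^ M * r m).re| ≤
          Cz * (E m ^ (M - k) * (‖εm m‖ * (A * ℓ m + B))) := by
        refine (Complex.abs_re_le_norm _).trans ?_
        rw [norm_mul, norm_mul (c M * z ^ M), norm_pow, Complex.norm_real, Real.norm_eq_abs,
          abs_of_pos (hEpos m), hCz]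
        have e1 : E m ^ M * ‖εm m‖ ^ 2 = E m ^ (M - k) * (‖εm m‖ * (E m ^ k * ‖εm m‖)) := by
          rw [show E m ^ M = E m ^ (M - k) * E m ^ k by rw [← pow_add, Nat.sub_add_cancel hkM.le]]
          ring
        have h5 : E m ^ M * ‖r m‖ ≤ E m ^ M * (Cr * ‖εm m‖ ^ 2) :=
          mul_le_mul_of_nonneg_left hse (by positivity)
        have h6 : ‖εm m‖ * (E m ^ k * ‖εm m‖) ≤ ‖εm m‖ * (A * ℓ m + B) :=
          mul_le_mul_of_nonneg_left (hEkε m) (norm_nonneg _)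
        have h7 : 0 ≤ E m ^ (M - k) := by positivity
        calc ‖c M * z ^ M‖ * E m ^ M * ‖r m‖ = ‖c M * z ^ M‖ * (E m ^ M * ‖r m‖) := by ring
          _ ≤ ‖c M * z ^ M‖ * (E m ^ M * (Cr * ‖εm m‖ ^ 2)) :=
              mul_le_mul_of_nonneg_left h5 (norm_nonneg _)
          _ = ‖c M * z ^ M‖ * Cr * (E m ^ (M - k) * (‖εm m‖ * (E m ^ k * ‖εm m‖))) := by
              rw [← e1]; ring
          _ ≤ ‖c M * z ^ M‖ * Cr * (E m ^ (M - k) * (‖εm m‖ * (A * ℓ m + B))) :=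
              mul_le_mul_of_nonneg_left (mul_le_mul_of_nonneg_left h6 h7) (by positivity)
      have h5 : |(R (s (J₀ + m))).re| ≤ CR := by rw [hCR]; exact (Complex.abs_re_le_norm _).trans hRm
      rw [hre m, hgR0, Polynomial.eval_zero, hsplit2 m, Complex.add_re, htopre' m]
      exact (abs_caseB_le _ _ _ _ _ _).trans (by linarith only [h1, h2, h3, h4, h5])
    -- the error is at most `(|κ₀|/2)·E^{M−k}ℓ` eventually (file LXXX(b))
    have hdom := eventually_errB_le hℓt hℓ0 hk hkM (E := E) (fun m => rfl) (εn := fun m => ‖εm m‖)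
      (fun m => norm_nonneg _) hA0 hB0 hEkε Clo Cmid Cw Cz CR (κ := |κ₀| / 2) (by positivity)
    have hreal : ∀ᶠ m in atTop,
        |κ₀| / 2 * Real.exp ((((M : ℝ) - k) / k) * ℓ m) ≤ |(p m (Sum.inl 1)).re| := by
      filter_upwards [hErr, hdom, hℓt.eventually (eventually_ge_atTop 1)] with m hEm hdm hℓ1
      have hEMk : Real.exp ((((M : ℝ) - k) / k) * ℓ m) = E m ^ (M - k) := by
        rw [hEpow, Nat.cast_sub hkM.le]; ring_nf
      rw [hEMk]
      have h1 : |κ₀ * (E m ^ (M - k) * ℓ m)| = |κ₀| * (E m ^ (M - k) * ℓ m) := by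
        rw [abs_mul, abs_of_nonneg (by positivity : (0 : ℝ) ≤ E m ^ (M - k) * ℓ m)]
      have h2 := abs_sub_abs_le_abs_sub (κ₀ * (E m ^ (M - k) * ℓ m)) (p m (Sum.inl 1)).re
      rw [abs_sub_comm, h1] at h2
      have h3 : |κ₀| / 2 * E m ^ (M - k) ≤ |κ₀| / 2 * (E m ^ (M - k) * ℓ m) :=
        mul_le_mul_of_nonneg_left (le_mul_of_one_le_right (by positivity) hℓ1) (by positivity)
      linarith only [h2, h3, hEm, hdm]
    have hα : (0 : ℝ) < ((M : ℝ) - k) / k := by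
      have : (k : ℝ) < M := by exact_mod_cast hkM
      exact div_pos (by linarith) hkR
    have hgr := tendsto_growth_ratio_of_exp_bounds hα (by positivity)
      (by positivity : (0 : ℝ) < |κ₀| / 2) hℓt hreal hnorm
    exact unprojectedDense_of_growth hS hdim 1 hpS hpΓ hgr
  · /- (A) `Re g ≢ 0`: polynomial growth at rate `E^d`, `d ≥ M − k + 1` -/
    set d := gR.natDegree with hd
    have hdmem : d ∈ T := by
      by_contra hnot
      have h := hgRcoeff d
      rw [if_neg hnot] at h
      exact (Polynomial.leadingCoeff_ne_zero.2 hgR0) h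
    have hdlo : M - k + 1 ≤ d := (Finset.mem_Ico.1 hdmem).1
    obtain ⟨c₀, hc₀, hgrow⟩ := eventually_mul_pow_le_abs_eval gR hgR0
    have hEt : Tendsto E atTop atTop := Real.tendsto_exp_atTop.comp (hℓt.atTop_div_const hkR)
    have hgrowE : ∀ᶠ m in atTop, c₀ * E m ^ d ≤ |gR.eval (E m)| := hEt.eventually hgrow
    have hdom := eventually_errA_le hℓt hℓ0 hk hdlo (E := E) (fun m => rfl) A B Clo Chi
      (CR := ‖R 0‖ + 1) (c := c₀ / 2) (by positivity) (by positivity)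
    have hreal : ∀ᶠ m in atTop, c₀ / 2 * Real.exp (((d : ℝ) / k) * ℓ m) ≤ |(p m (Sum.inl 1)).re| := by
      filter_upwards [hgrowE, hdom, hlowb, hcorrb, hRb] with m hgm hdm hlo hco hRm
      have hEd : Real.exp (((d : ℝ) / k) * ℓ m) = E m ^ d := by rw [hEpow]; ring_nf
      rw [hEd, hre m]
      have h1 : |(low m).re| ≤ Clo * E m ^ (M - k) := (Complex.abs_re_le_norm _).trans hlo
      have h2 : |(hiCorr m).re| ≤ Chi * (E m ^ (M - k) * (A * ℓ m + B)) :=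
        (Complex.abs_re_le_norm _).trans hco
      have h3 : |(R (s (J₀ + m))).re| ≤ ‖R 0‖ + 1 := (Complex.abs_re_le_norm _).trans hRm
      have h4 := abs_caseA_le (low m).re (gR.eval (E m)) (hiCorr m).re (R (s (J₀ + m))).re
      linarith only [h4, h1, h2, h3, hgm, hdm]
    have hα : (0 : ℝ) < (d : ℝ) / k := by
      have : (1 : ℝ) ≤ d := by exact_mod_cast (show 1 ≤ d by omega)
      positivity
    have hgr := tendsto_growth_ratio_of_exp_bounds hα (by positivity) (by positivity : (0 : ℝ) < c₀ / 2)
      hℓt hreal hnorm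
    exact unprojectedDense_of_growth hS hdim 1 hpS hpΓ hgr

end Summit.Schanuel.Schanuel.Theorems
end
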